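import Mathlib
import Summits.Ventures.PercRepro2.Defs
import Summits.Ventures.PercRepro2.Graph
import Summits.Ventures.PercRepro2.OneColourSwitch
import Summits.Ventures.PercRepro2.RegionHubSign
import Summits.Ventures.PercRepro2.SideSwitch
import Summits.Ventures.PercRepro2.SideSwitchFibre
import Summits.Ventures.PercRepro2.SideSwitchClosed
import Summits.Ventures.PercRepro2.SideSwitchComps
import Summits.Ventures.PercRepro2.M9NoPocketDefs
import Summits.Ventures.PercRepro2.M9NoPocketWorld
import Summits.Ventures.PercRepro2.M9NoPocketFibre
import Summits.Ventures.PercRepro2.M9NoPocketCompl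
import Summits.Ventures.PercRepro2.M9RegionSplit
import Summits.Ventures.PercRepro2.M9PocketCubeDefs
import Summits.Ventures.PercRepro2.M9PocketCubeFibre
import Summits.Ventures.PercRepro2.M9PocketCubeCompl
import Summits.Ventures.PercRepro2.M9PocketCubeHub
import Summits.Ventures.PercRepro2.M9PocketCubeWorldMono
import Summits.Ventures.PercRepro2.M9DeadEnd
import Summits.Ventures.PercRepro2.M9DeadEndMono
import Summits.Ventures.PercRepro2.M9DeadEndHarris
import Summits.Ventures.PercRepro2.M9LinkedHubCube
import Summits.Ventures.PercRepro2.M9LinkedGroup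

/-!
# The group interval: `T`-edges `Y`, fixed blocks unswitched, `d ∉ M₂`, and the `Y`-pocket closed
(blind cell PercRepro2, p3 g29, 2026-08-28; step (iii) of the `Y`-pocket-group plan, part 1)

On the group interval of a cube vector `x` (`M9LinkedGroup`): every `T`-edge is `Y`
(`assignX_Tset_eq_true_of_mem_groupInterval`), every block adjacent to `d` or attached to the
`Y`-pocket of `x` stays unswitched, so **`d ∉ M₂`** (`not_mem_M2_of_mem_groupInterval`: the last
edge of a `W`-path to `d` would be a `W` `T`-edge or lead into a switched block adjacent to `d`);
the `Y`-pocket of `x` is **closed under `Y`-adjacency in `G − d`** (`pocketY_closed_endsD`: a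
`Y`-edge out of the pocket would enter an attached block, whose edges to the pocket are `W` in
the representative and unswitched on the interval); a `Y` pocket edge at `d` leads into the
`Y`-pocket of `x` (`mem_pocketY_of_pocket_edge_d`) and `G − d`-connections from the pocket stay
in it (`mem_pocketY_of_conn_endsD`).  Part 2 (`M9LinkedGroupLegal`) derives `Sep`, `DOne` and
`d ∈ K₂` on the interval.  Own work; std axioms.
-/

namespace Summit.Ventures.PercRepro2

namespace NoPocket

open Finset Classical RegionHub OneColourSwitch SideSwitch

variable {V : Type*} {E : Type*}

section Legal

variable [Fintype V] [DecidableEq V] [Fintype E] [DecidableEq E] {ends : E → Sym2 V}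
  {p q r s d : V}

/-- Every `T`-edge is `Y` on the group interval. -/
lemma assignX_Tset_eq_true_of_mem_groupInterval (hr : d ≠ r) (hs : d ≠ s) {ρ : Config E}
    (hρ : ρ ∈ RepP ends p q r s d) {x y : Finset (Finset V) × Finset E}
    (h : y ∈ groupInterval ends d r s ρ x) {e : E} (he : e ∈ Tset ends d r s) :
    assignX ends y ρ e = true := by
  obtain ⟨hρD, _⟩ := mem_RepP.1 hρ
  obtain ⟨hT, _⟩ := mem_cubeP.1 (mem_cubeP_of_mem_groupInterval h)
  obtain ⟨_, _, hρT⟩ := mem_RepD.1 hρD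
  rw [assignX_Tset hρD hT hr hs he, if_neg (fun hy => notMem_Tset_of_mem_groupInterval h hy he)]
  exact hρT e he

/-- A block adjacent to `d` is unswitched on the group interval. -/
lemma notMem_fst_of_adj_d_of_mem_groupInterval {ρ : Config E} {x y : Finset (Finset V) × Finset E}
    (h : y ∈ groupInterval ends d r s ρ x) {C : Finset V} (hC : C ∈ blocks ends d r s ρ) {e : E}
    {u : V} (hends : ends e = s(d, u)) (hu : u ∈ C) : C ∉ y.1 :=
  fun hy => notMem_fixedBlocks_of_mem_groupInterval h hy
    (Finset.mem_filter.2 ⟨hC, Or.inl ⟨e, u, hends, hu⟩⟩)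

/-- A block attached to the `Y`-pocket of `x` is unswitched on the group interval. -/
lemma notMem_fst_of_attached_of_mem_groupInterval {ρ : Config E}
    {x y : Finset (Finset V) × Finset E} (h : y ∈ groupInterval ends d r s ρ x) {C : Finset V}
    (hC : C ∈ blocks ends d r s ρ) {e : E} {u v : V} (hends : ends e = s(u, v)) (hu : u ∈ C)
    (hv : v ∈ pocketY ends d r s ρ x) (hvd : v ≠ d) : C ∉ y.1 :=
  fun hy => notMem_fixedBlocks_of_mem_groupInterval h hy
    (Finset.mem_filter.2 ⟨hC, Or.inr ⟨e, u, v, hends, hu, hv, hvd⟩⟩)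

/-- **`d ∉ M₂` on the group interval.** -/
theorem not_mem_M2_of_mem_groupInterval (hr : d ≠ r) (hs : d ≠ s) {ρ : Config E}
    (hρ : ρ ∈ RepP ends p q r s d) {x y : Finset (Finset V) × Finset E}
    (h : y ∈ groupInterval ends d r s ρ x) : d ∉ M2 ends r s (assignX ends y ρ) := by
  intro hM
  obtain ⟨hρD, _⟩ := mem_RepP.1 hρ
  obtain ⟨hT, hF⟩ := mem_cubeP.1 (mem_cubeP_of_mem_groupInterval h)
  obtain ⟨_, hMρ, _⟩ := mem_RepD.1 hρD
  have hex : ∃ t, (t = r ∨ t = s) ∧ Conn ends (OneColourSwitch.compl (assignX ends y ρ)) t d := by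
    rcases mem_M2_iff.1 hM with h1 | h1
    · exact ⟨r, Or.inl rfl, h1⟩
    · exact ⟨s, Or.inr rfl, h1⟩
  obtain ⟨t, ht, hc⟩ := hex
  have htd : t ≠ d := by
    rcases ht with h1 | h1 <;> rw [h1]
    · exact hr.symm
    · exact hs.symm
  obtain ⟨e, u, hends, he, hc'⟩ := conn_d_decomp htd hc
  have huM : u ∈ M2 (endsD ends d) r s (assignX ends y ρ) := by
    rcases ht with h1 | h1 <;> rw [h1] at hc'
    · exact mem_M2_iff.2 (Or.inl hc')
    · exact mem_M2_iff.2 (Or.inr hc')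
  rw [M2_endsD_assignX' hr hs hρD hT hF] at huM
  rcases huM with huM | huT
  · -- `u ∈ {r, s}`: the `T`-edge `e` is `Y` on the interval
    have hTe : e ∈ Tset ends d r s := by
      rcases hMρ u huM with h1 | h1 <;> rw [h1] at hends
      · exact mem_Tset.2 (Or.inl hends)
      · exact mem_Tset.2 (Or.inr hends)
    have hY := assignX_Tset_eq_true_of_mem_groupInterval hr hs hρ h hTe
    simp only [OneColourSwitch.compl] at he
    rw [hY] at he
    exact absurd he (by decide)
  · -- `u` lies in a switched block adjacent to `d`: impossible
    obtain ⟨C, hC, huC⟩ := mem_unionT.1 (Finset.mem_coe.1 huT)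
    exact notMem_fst_of_adj_d_of_mem_groupInterval h (hT hC) hends huC hC

omit [Fintype V] in
/-- A vertex of the `Y`-pocket of `x` is not in `{r, s}`. -/
lemma ne_rs_of_mem_pocketY (hr : d ≠ r) (hs : d ≠ s) {ρ : Config E}
    {x : Finset (Finset V) × Finset E} {v : V} (hv : v ∈ pocketY ends d r s ρ x) :
    v ≠ r ∧ v ≠ s := by
  have hvO := mem_Oprime_of_mem_pocketY hr hs hv
  constructor
  · rintro rfl
    exact (mem_Oprime.1 hvO).2 (mem_M2_iff.2 (Or.inl (conn_refl _ _ _)))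
  · rintro rfl
    exact (mem_Oprime.1 hvO).2 (mem_M2_iff.2 (Or.inr (conn_refl _ _ _)))

/-- **The `Y`-pocket of `x` is closed under `Y`-adjacency in `G − d` at every point of the
group interval**: a `Y`-edge out of the pocket would lead into an attached block, whose edges to
the pocket are `W` in the representative and unswitched on the interval. -/
theorem pocketY_closed_endsD (hr : d ≠ r) (hs : d ≠ s) {ρ : Config E}
    (hρ : ρ ∈ RepP ends p q r s d) {x y : Finset (Finset V) × Finset E}
    (hx : x ∈ cubeP ends d r s ρ) (h : y ∈ groupInterval ends d r s ρ x) :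
    ∀ a ∈ pocketY ends d r s ρ x, ∀ b,
      (openGraph (endsD ends d) (assignX ends y ρ)).Adj a b → b ∈ pocketY ends d r s ρ x := by
  intro a ha b hab
  obtain ⟨hρD, _⟩ := mem_RepP.1 hρ
  obtain ⟨hT, hF⟩ := mem_cubeP.1 (mem_cubeP_of_mem_groupInterval h)
  obtain ⟨hne, e, he, hends⟩ := openGraph_adj.1 hab
  -- the edge is not at `d`
  have hde : d ∉ ends e := by
    intro hd
    rw [endsD_of_mem hd, Sym2.eq_iff] at hends
    rcases hends with ⟨h1, h2⟩ | ⟨h1, h2⟩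
    · exact hne (h1.symm.trans h2)
    · exact hne (h2.symm.trans h1)
  rw [endsD_of_notMem hde] at hends
  have haO := mem_Oprime_of_mem_pocketY hr hs ha
  have had : a ≠ d := by
    rintro rfl
    apply hde
    rw [hends]
    exact Sym2.mem_mk_left _ _
  rcases edge_trichotomy hr hs hρD e with h1 | ⟨C, hC, z, hz, w, hzw⟩ | h1
  · -- inside `{r, s}`: `a` would be `r` or `s`
    exfalso
    obtain ⟨y₁, hy₁, z₁, hz₁, hyz⟩ := h1
    rw [hends, Sym2.eq_iff] at hyz
    obtain ⟨har, has⟩ := ne_rs_of_mem_pocketY hr hs ha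
    have ha' : a ∈ ({r, s} : Set V) := by
      rcases hyz with ⟨h2, _⟩ | ⟨h2, _⟩
      · rw [h2]
        exact hy₁
      · rw [h2]
        exact hz₁
    rcases ha' with h3 | h3
    · exact har h3
    · exact has h3
  · -- the edge touches the block `C` at `z`: `z = b` and `C` is attached to the pocket
    have hzO : z ∉ Oprime ends d r s ρ := fun hzO =>
      (mem_Oprime.1 hzO).1 (mem_K2_endsD_of_mem_block hρD hC hz)
    have hzb : z = b := by
      rw [hends, Sym2.eq_iff] at hzw
      rcases hzw with ⟨h2, _⟩ | ⟨_, h2⟩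
      · exact absurd (h2 ▸ haO) hzO
      · exact h2.symm
    rw [hzb] at hz
    have hends' : ends e = s(b, a) := by rw [hends, Sym2.eq_swap]
    have hCy : C ∉ y.1 :=
      notMem_fst_of_attached_of_mem_groupInterval h hC hends' hz ha had
    have hval := assignX_touch_block hρD hT hF hr hs hC hz hends'
    rw [if_neg hCy] at hval
    -- in the representative the edge is `W` (a `Y` edge would put `a` into the `Y`-world)
    have hρe : ρ e = false := by
      by_contra hne'
      rw [Bool.not_eq_false] at hne'
      have hbK : b ∈ K2 (endsD ends d) r s ρ := mem_K2_endsD_of_mem_block hρD hC hz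
      have hconn : Conn (endsD ends d) ρ b a :=
        conn_of_openAdj ⟨e, hne', by rw [endsD_of_notMem hde]; exact hends'⟩
      apply (mem_Oprime.1 haO).1
      rcases mem_K2_iff.1 hbK with h2 | h2
      · exact mem_K2_iff.2 (Or.inl (conn_trans h2 hconn))
      · exact mem_K2_iff.2 (Or.inr (conn_trans h2 hconn))
    rw [hval, hρe] at he
    exact absurd he (by decide)
  · rcases mem_freeE.1 h1 with hTe | hPe
    · -- a `T`-edge is at `d`
      exfalso
      apply hde
      rcases mem_Tset.1 hTe with h2 | h2 <;> rw [h2] <;> exact Sym2.mem_mk_left _ _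
    · -- a pocket edge: the pocket colouring is open on it, so `b` is in the `Y`-pocket of `y`
      rw [← pocketY_eq_of_mem_groupInterval hρD hx h]
      have hopen : (openGraph ends (pocketCfg ends d r s ρ (assignX ends y ρ))).Adj a b := by
        refine openGraph_adj.2 ⟨hne, e, ?_, hends⟩
        simp only [pocketCfg]
        rw [if_pos hPe]
        exact he
      have ha' : a ∈ pocketY ends d r s ρ y := by
        rw [pocketY_eq_of_mem_groupInterval hρD hx h]
        exact ha
      exact expl_closed a ha' b hopen

omit [Fintype V] in
/-- `d` lies in its own `Y`-pocket. -/
lemma d_mem_pocketY {ρ : Config E} (x : Finset (Finset V) × Finset E) :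
    d ∈ pocketY ends d r s ρ x :=
  ⟨d, rfl, conn_refl _ _ _⟩

/-- A `Y` pocket edge at `d` on the group interval leads into the `Y`-pocket of `x`. -/
lemma mem_pocketY_of_pocket_edge_d {ρ : Config E} (hρ : ρ ∈ RepD ends p q r s d)
    {x y : Finset (Finset V) × Finset E} (hx : x ∈ cubeP ends d r s ρ)
    (h : y ∈ groupInterval ends d r s ρ x) {e : E} {u : V} (hends : ends e = s(d, u))
    (hPe : e ∈ Pk ends d r s ρ) (he : assignX ends y ρ e = true) :
    u ∈ pocketY ends d r s ρ x := by
  obtain ⟨hT, _⟩ := mem_cubeP.1 hx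
  obtain ⟨hT', _⟩ := mem_cubeP.1 (mem_cubeP_of_mem_groupInterval h)
  have heZ : e ∈ EZ ends d r s ρ x :=
    Finset.mem_filter.2 ⟨hPe, mem_touches_of_ends hends (Or.inl (d_mem_pocketY x))⟩
  have hagree := inter_EZ_eq_of_mem_groupInterval h
  have hex : assignX ends x ρ e = true := by
    rw [assignX_Pk hρ hT hPe]
    rw [assignX_Pk hρ hT' hPe] at he
    by_cases hey : e ∈ y.2
    · have : e ∈ x.2 := (Finset.mem_inter.1 (hagree ▸ Finset.mem_inter.2 ⟨hey, heZ⟩)).1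
      rw [if_pos this]
      rw [if_pos hey] at he
      exact he
    · have : e ∉ x.2 := fun hex =>
        hey (Finset.mem_inter.1 (hagree.symm ▸ Finset.mem_inter.2 ⟨hex, heZ⟩)).1
      rw [if_neg this]
      rw [if_neg hey] at he
      exact he
  by_cases hud : u = d
  · rw [hud]
    exact d_mem_pocketY x
  · refine expl_closed d (d_mem_pocketY x) u (openGraph_adj.2 ⟨Ne.symm hud, e, ?_, hends⟩)
    simp only [pocketCfg]
    rw [if_pos hPe]
    exact hex

/-- A `G − d`-connection from the `Y`-pocket of `x` stays in it, at every point of the group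
interval. -/
lemma mem_pocketY_of_conn_endsD (hr : d ≠ r) (hs : d ≠ s) {ρ : Config E}
    (hρ : ρ ∈ RepP ends p q r s d) {x y : Finset (Finset V) × Finset E}
    (hx : x ∈ cubeP ends d r s ρ) (h : y ∈ groupInterval ends d r s ρ x) {u w : V}
    (hu : u ∈ pocketY ends d r s ρ x) (hc : Conn (endsD ends d) (assignX ends y ρ) u w) :
    w ∈ pocketY ends d r s ρ x :=
  mem_of_conn_of_closed (pocketY_closed_endsD hr hs hρ hx h) hu hc


end Legal

end NoPocket

end Summit.Ventures.PercRepro2
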